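import Summits.ValiantsHypothesis.ValiantsHypothesis.Theorems.DivisionGapZeroOneTransferSpanReduction
import Summits.ValiantsHypothesis.ValiantsHypothesis.Theorems.DivisionGapZeroOneTransferSpanOfCertificate

/-!
# Line `arborescence-span` for crux `ZeroOneTransfer` (stmt-ValiantsHypothesis-5066, route DivisionGap)

Lead's skeleton, FINAL SHAPE (continuation lead prover-line-stmt-ValiantsHypothesis-5066-c1-0,
2026-08-16), reshaped from the opening lead's `Cruxes/ZeroOneTransfer/Lines/arborescence_span.lean`.

## Status

Every piece of scaffolding of the line is a theorem of the tree:

* `stub_projClosure` — `Theorems/DivisionGapZeroOneTransferProjClosure.lean` (p89287);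
* `stub_formulaToIMM` — `Theorems/DivisionGapZeroOneTransferFormulaToIMM.lean` (p87339);
* `stub_immToSpan` (padding lemma) — `Theorems/DivisionGapZeroOneTransferIMMToSpan*.lean` (p94655);
* S1 `stub_signedSpan` — `Theorems/DivisionGapZeroOneTransferSignedSpan.lean` (p95399);
* converse normal form `stub_spanOfCertificate`, `span_of_monotone`, `span_of_zeroOneTransferDeg` —
  `Theorems/DivisionGapZeroOneTransferSpanOfCertificate.lean` (p96452);
* the reduction `stub_spanReduction : SignElimination → ZeroOneTransfer` —
  `Theorems/DivisionGapZeroOneTransferSpanReduction.lean` (p96454).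

So the skeleton has exactly ONE registered stub, the bet `stub_signElimination` (S2, Kirchhoff sign
elimination for 0/1 polynomials, finitary and uniform), and the composition `ZeroOneTransfer_of` is
the tree's reduction applied to it.

## Honest status of the bet

S2 ⟹ `ZeroOneTransfer` (tree) and `ZeroOneTransfer` + quasi-polynomial cofactor DEGREE ⟹ S2
(`span_of_zeroOneTransferDeg`, tree, up to the compactness/uniformity step): S2 is the crux in
Kirchhoff normal form, strictly above it only by the cofactor-degree clause (Disproof (B2) regime).
Decisive instance: Valiant's triangular-lattice dimers `D_n` (crux `TriangularDimersDivisionEasy`,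
stmt-ValiantsHypothesis-5067; FominGrigorievKoshevoy2014 Rem. 1.5).

## Disproof.lean items honoured (re-read 2026-08-16 by the continuation lead)

(A) `zeroOneTransfer_false_without_VP`: `VP` enters through S1 only.  (B) `not_zeroOneTransferNoDivision`,
(B2) `Negative/LowDegreeCofactor`, (E) Pólya / few rows: the certificate's cofactor is
`ΣA'_i · (star–mesh pivots)`, degree `≈ deg f`, all rows — S2 does not bound cofactor degree below
`deg f`.  (C)/(D): `D_n` and the face criterion hit S2 exactly where they hit the crux.  (G)
`not_posProj_stPoly_sum`: single `ST`-quotients are not closed under sums — S2 keeps `I, J`-term sums.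
-/

noncomputable section

namespace Summit.ValiantsHypothesis.ValiantsHypothesis.Cruxes.ZeroOneTransfer.ArborescenceSpan

set_option linter.dupNamespace false

open Literature.Computability.AlgebraicComplexity Literature.Barriers.ValiantsHypothesis
open MvPolynomial Finset
open scoped NNReal

open Summit.ValiantsHypothesis.ValiantsHypothesis.Theses.DivisionGap (ZeroOneTransfer)
open Summit.ValiantsHypothesis.ValiantsHypothesis.Theorems.DivisionGapZeroOneTransfer
  (stub_spanReduction stub_signedSpan stub_projClosure)

/-! ### The stub statement (tree vocabulary only) -/

/-- Statement of `stub_signElimination` (S2, the bet — Kirchhoff sign elimination, finitary and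
uniform): ONE constant `c` such that for every `N`, every finite variable type, every 0/1-coefficient
`f` and every signed representation `f · A + C = B` by positive projections of `ST_N` with `A ≠ 0`,
there is an unsigned one `f · Σ_{i<I} A'_i = Σ_{j<J} B'_j` by positive projections of `ST_{N'}` with
`Σ A'_i ≠ 0` and `N', I, J ≤ 2^{(log₂ N + c)^c}`. [folklore] -/
def SignElimination : Prop :=
  ∃ c : ℕ, ∀ (N : ℕ) (τ : Type) [Fintype τ] (f : MvPolynomial τ ℝ≥0),
    (∀ m, MvPolynomial.coeff m f = 0 ∨ MvPolynomial.coeff m f = 1) →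
    ∀ A B C : MvPolynomial τ ℝ≥0,
      IsProjection A (stPoly ℝ≥0 N) → IsProjection B (stPoly ℝ≥0 N) →
      IsProjection C (stPoly ℝ≥0 N) → A ≠ 0 → f * A + C = B →
      ∃ N' ≤ 2 ^ ((Nat.log 2 N + c) ^ c), ∃ I ≤ 2 ^ ((Nat.log 2 N + c) ^ c),
        ∃ J ≤ 2 ^ ((Nat.log 2 N + c) ^ c),
        ∃ (A' : Fin I → MvPolynomial τ ℝ≥0) (B' : Fin J → MvPolynomial τ ℝ≥0),
          (∀ i, IsProjection (A' i) (stPoly ℝ≥0 N')) ∧ (∀ j, IsProjection (B' j) (stPoly ℝ≥0 N')) ∧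
          (∑ i, A' i) ≠ 0 ∧ f * ∑ i, A' i = ∑ j, B' j

/-! ### The registered stub (`sorry` lives only here) -/

/-- **stub — Kirchhoff sign elimination (S2)** (`SignElimination`), THE BET of the line, stated
finitarily; held by the lead.  Evidence: true for `f = ST` (trivial), for CDGM's `F ∓ εST` (Markov
chain tree theorem), for every monotone ABP (padding lemma, `C = 0`), for regular-matroid basis
polynomials in `{+,×,÷}` form (Hertrich–Kober–Loho 2025 Thm 1, arXiv:2511.02406); open exactly where
the crux is open (Valiant's triangular-lattice dimers = crux `TriangularDimersDivisionEasy`,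
FominGrigorievKoshevoy2014 Rem. 1.5).  WARNING (planner's finding, now kernel-checked in both
directions up to compactness): S2 is `ZeroOneTransfer` with a quasi-polynomial-degree clause on the
certificate, in Kirchhoff normal form — the crux restated, not a strictly easier statement.
Size: open problem. [cite: FominGrigorievKoshevoy2014, Remark 1.5] -/
theorem stub_signElimination :
    ∃ c : ℕ, ∀ (N : ℕ) (τ : Type) [Fintype τ] (f : MvPolynomial τ NNReal),
      (∀ m, MvPolynomial.coeff m f = 0 ∨ MvPolynomial.coeff m f = 1) →
      ∀ A B C : MvPolynomial τ NNReal,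
        Literature.Computability.AlgebraicComplexity.IsProjection A
            (Literature.Barriers.ValiantsHypothesis.stPoly NNReal N) →
        Literature.Computability.AlgebraicComplexity.IsProjection B
            (Literature.Barriers.ValiantsHypothesis.stPoly NNReal N) →
        Literature.Computability.AlgebraicComplexity.IsProjection C
            (Literature.Barriers.ValiantsHypothesis.stPoly NNReal N) →
        A ≠ 0 → f * A + C = B →
        ∃ N' ≤ 2 ^ ((Nat.log 2 N + c) ^ c), ∃ I ≤ 2 ^ ((Nat.log 2 N + c) ^ c),
          ∃ J ≤ 2 ^ ((Nat.log 2 N + c) ^ c),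
          ∃ (A' : Fin I → MvPolynomial τ NNReal) (B' : Fin J → MvPolynomial τ NNReal),
            (∀ i, Literature.Computability.AlgebraicComplexity.IsProjection (A' i)
                (Literature.Barriers.ValiantsHypothesis.stPoly NNReal N')) ∧
            (∀ j, Literature.Computability.AlgebraicComplexity.IsProjection (B' j)
                (Literature.Barriers.ValiantsHypothesis.stPoly NNReal N')) ∧
            (∑ i, A' i) ≠ 0 ∧ f * ∑ i, A' i = ∑ j, B' j := by
  sorry

/-! ### Name-keyed alias of the stub statement (the audit admits a hypothesis of the concluding
theorem only if its head constant is a registered obligation or is named like a declared stub) -/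
namespace Registered

/-- Alias of `SignElimination` keyed by the registered stub name. [folklore] -/
abbrev stub_signElimination : Prop := SignElimination

end Registered

/-! ### Consistency: the named statement IS its registered stub (definitionally), and the two
formerly registered stubs are now theorems of the tree with the registered signatures -/

/-- `SignElimination` is the registered `stub_signElimination`. [folklore] -/
theorem signElimination_holds : SignElimination := stub_signElimination

/-- Former stub `stub_projClosure` (wave 1), now the tree theorem
`Theorems.DivisionGapZeroOneTransfer.stub_projClosure` (p89287), same signature. [folklore] -/
example :
    ∀ (ι τ : Type) (p : MvPolynomial ι NNReal) (q : MvPolynomial τ NNReal),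
      Literature.Computability.AlgebraicComplexity.IsProjection q p →
      ∀ h : MvPolynomial ι NNReal, h ≠ 0 →
        ∃ h' : MvPolynomial τ NNReal, h' ≠ 0 ∧
          Literature.Computability.AlgebraicComplexity.complexity (q * h') +
              Literature.Computability.AlgebraicComplexity.complexity h' ≤
            Literature.Computability.AlgebraicComplexity.complexity (p * h) +
              Literature.Computability.AlgebraicComplexity.complexity h :=
  stub_projClosure

/-- Former stub `stub_signedSpan` (S1), now the tree theorem
`Theorems.DivisionGapZeroOneTransfer.stub_signedSpan` (p95399), same signature. [folklore] -/
example :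
    ∀ (σ : ℕ → Type) [∀ n, Fintype (σ n)] (f : ∀ n, MvPolynomial (σ n) NNReal),
      Literature.Computability.AlgebraicComplexity.IsVPFamily (k := ℂ)
        (fun n => MvPolynomial.map (Complex.ofRealHom.comp NNReal.toRealHom) (f n)) →
      ∃ c : ℕ, ∀ n, ∃ N ≤ 2 ^ ((Nat.log 2 n + c) ^ c),
        ∃ A B C : MvPolynomial (σ n) NNReal,
          Literature.Computability.AlgebraicComplexity.IsProjection A
              (Literature.Barriers.ValiantsHypothesis.stPoly NNReal N) ∧
          Literature.Computability.AlgebraicComplexity.IsProjection B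
              (Literature.Barriers.ValiantsHypothesis.stPoly NNReal N) ∧
          Literature.Computability.AlgebraicComplexity.IsProjection C
              (Literature.Barriers.ValiantsHypothesis.stPoly NNReal N) ∧
          A ≠ 0 ∧ f n * A + C = B :=
  stub_signedSpan

/-! ### The kernel-checked composition -/

/-- **`ZeroOneTransfer` from the registered stub** — the ONLY theorem of this file concluding the
crux by name: Kirchhoff sign elimination (S2) is fed to the tree's reduction `stub_spanReduction`
(S1 + S2 ⇒ two-sided span ⇒ quasi-polynomial division complexity via projection closure,
`StDivisionEasy` and the sum/quotient closure, attained by a nonzero cofactor). [folklore] -/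
theorem ZeroOneTransfer_of (h : Registered.stub_signElimination) : ZeroOneTransfer :=
  stub_spanReduction h

/-- Wiring check: the registered stub feeds `ZeroOneTransfer_of` as stated. -/
example : ZeroOneTransfer := ZeroOneTransfer_of stub_signElimination

end Summit.ValiantsHypothesis.ValiantsHypothesis.Cruxes.ZeroOneTransfer.ArborescenceSpan

end
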